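import Summits.ResolutionOfSingularities.ResolutionOfSingularities.Theorems.DeltaCutStellarJet
import Literature.AlgebraicGeometry.Resolution.BlowupStalkCharts

/-!
# δ-cut, stellar NC-HYP arm — «JetCut» §Round: exponents, the extended derivation, `p`-divisible points through a round (T19b-ii)

[OURS · decomp-res-lens-6 g35 · column item `E1TopNoAbs` (stmt-ResolutionOfSingularities-26971)]  Second slice of the «JetCut»
round engine (see `Theorems/DeltaCutStellarJet.lean` for the class and the plan): the exponents of the strict transforms and of the
exceptional divisor at a point (`expOf_transformExp_strict/comap`), the pulled-back monomial `𝓜_y𝒪' = Fⁿ·𝓜'`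
(`map_stalkIdeal_monomialIdeal_eq`), `m₀ᵖ ∈ 𝓜_y ⇒ m₀ ∈ C_y`, THE DERIVATION EXTENDS THROUGH THE ROUND
(`exists_isDeriv_transform`: labelled parameters span `C_y`, `IsBlowup.exists_reesChart_stalk`, T19a), and `p`-DIVISIBLE POINTS OF
`V(H')` LIE OVER `p`-DIVISIBLE POINTS under the star bounds (`divPt_of_divPt_transform`, via the phase dichotomy `star_dichotomy`).
0 sorry. [new] [cite: Kollar2007, (3.111) Step 3] [cite: StacksProject, Tag 0804] [cite: Matsumura1987, §25]
-/
noncomputable section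

open CategoryTheory CategoryTheory.Limits AlgebraicGeometry TopologicalSpace IsLocalRing
open Literature.AlgebraicGeometry.Resolution

namespace Summit.ResolutionOfSingularities.ResolutionOfSingularities.Theorems.DeltaCutClasses

open Summit.ResolutionOfSingularities.ResolutionOfSingularities.Theorems
open WeakOrderReduction ForcedTowerClasses

/-! ### §Round — exponents and supports after a face round -/

section Round

variable {X X' : Scheme.{0}} [IsLocallyNoetherian X] {π : X' ⟶ X} {H : X.IdealSheafData}
  {E : List (X.IdealSheafData × ℕ)} {T : Finset X.IdealSheafData} {p : ℕ} {M : MarkedIdeal X}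

/-- **the exponent of a strict transform through a point is the old exponent.** [cite: Kollar2007, (3.111) Step 3] -/
theorem expOf_transformExp_strict (hEs : HasSNC (H :: boundaryOf E)) (hT : ∀ K ∈ T, K ∈ H :: boundaryOf E)
    (hπ : IsBlowup π (T.sup id)) (m : ℕ) {K : X.IdealSheafData} (hK : K ∈ boundaryOf E) {x' : X'}
    (hx' : x' ∈ (strictTransformIdeal π (T.sup id) K).support) :
    expOf (transformExp E π T m) (strictTransformIdeal π (T.sup id) K) = expOf E K := by
  classical
  haveI : IsProper π := hπ.isProper
  haveI : IsLocallyNoetherian X' := LocallyOfFiniteType.isLocallyNoetherian π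
  have hKE : K ∈ H :: boundaryOf E := List.mem_cons_of_mem _ hK
  rw [expOf, weightOf_transformExp]
  by_cases hF : (T.sup id).comap π ∈ ({strictTransformIdeal π (T.sup id) K} : Finset X'.IdealSheafData)
  · exfalso
    have hF' : (T.sup id).comap π = strictTransformIdeal π (T.sup id) K := Finset.mem_singleton.mp hF
    have hxF : x' ∈ ((T.sup id).comap π).support := by rw [hF']; exact hx'
    exact strictTransformIdeal_ne_comap hEs hT hπ hKE hxF hF'.symm
  · rw [if_neg hF, add_zero]
    have hpre : pre E π T {strictTransformIdeal π (T.sup id) K} = {K} := by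
      refine Finset.eq_singleton_iff_unique_mem.mpr ⟨mem_pre_iff.mpr ⟨mem_sheaves_iff.mpr hK, Finset.mem_singleton_self _⟩,
        fun K₁ hK₁ => ?_⟩
      obtain ⟨hK₁s, hK₁G⟩ := mem_pre_iff.mp hK₁
      rw [Finset.mem_singleton] at hK₁G
      exact (eq_of_strictTransformIdeal_eq hEs hT hπ hKE (List.mem_cons_of_mem _ (mem_sheaves_iff.mp hK₁s)) hx'
        hK₁G.symm).symm
    rw [hpre]
    rfl

/-- **the exponent of the exceptional divisor through a point is `weightOf E T − m`.** [cite: Kollar2007, (3.111) Step 3] -/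
theorem expOf_transformExp_comap (hEs : HasSNC (H :: boundaryOf E)) (hT : ∀ K ∈ T, K ∈ H :: boundaryOf E)
    (hπ : IsBlowup π (T.sup id)) (m : ℕ) {x' : X'} (hx' : x' ∈ ((T.sup id).comap π).support) :
    expOf (transformExp E π T m) ((T.sup id).comap π) = weightOf E T - m := by
  classical
  haveI : IsProper π := hπ.isProper
  haveI : IsLocallyNoetherian X' := LocallyOfFiniteType.isLocallyNoetherian π
  rw [expOf, weightOf_transformExp, if_pos (Finset.mem_singleton_self _)]
  have hpre : pre E π T {(T.sup id).comap π} = ∅ := by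
    refine Finset.eq_empty_of_forall_notMem fun K hK => ?_
    obtain ⟨hKs, hKG⟩ := mem_pre_iff.mp hK
    rw [Finset.mem_singleton] at hKG
    exact strictTransformIdeal_ne_comap hEs hT hπ (List.mem_cons_of_mem _ (mem_sheaves_iff.mp hKs)) hx' hKG
  rw [hpre, weightOf_empty, zero_add]

/-- **over the centre, a member NOT on the face lifts through every point above**: `K ∉ T`, `π x' ∈ V(K)` ⇒ `x' ∈ V(K')`
(total transform = strict transform, stalk maps local). [folklore] -/
theorem mem_support_strict_of_not_mem_face (hEs : HasSNC (H :: boundaryOf E)) (hT : ∀ K ∈ T, K ∈ H :: boundaryOf E)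
    (hπ : IsBlowup π (T.sup id)) {K : X.IdealSheafData} (hK : K ∈ H :: boundaryOf E) (hKT : K ∉ T) {x' : X'}
    (hy : π x' ∈ K.support) : x' ∈ (strictTransformIdeal π (T.sup id) K).support := by
  haveI : IsProper π := hπ.isProper
  haveI : IsLocallyNoetherian X' := LocallyOfFiniteType.isLocallyNoetherian π
  rw [mem_support_iff_stalkIdeal_le, ← map_stalkIdeal_eq_of_not_mem hEs hT hπ hK hKT x']
  exact (Ideal.map_mono ((mem_support_iff_stalkIdeal_le K _).mp hy)).trans (IsLocalRing.map_maximalIdeal_le _)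

/-- **the pulled-back monomial**: `𝓜(E)_y·𝒪' = F_{x'}ⁿ · 𝓜(E')_{x'}` for `E' = transformExp E π T n`, `n ≤ weightOf E T`.
[cite: Kollar2007, (3.111) Step 3] -/
theorem map_stalkIdeal_monomialIdeal_eq (hEs : HasSNC (H :: boundaryOf E)) (hT : ∀ K ∈ T, K ∈ H :: boundaryOf E)
    (hπ : IsBlowup π (T.sup id)) {n : ℕ} (hnT : n ≤ weightOf E T) (x' : X') :
    (stalkIdeal (monomialIdeal E) (π x')).map (π.stalkMap x').hom =
      stalkIdeal ((T.sup id).comap π) x' ^ n * stalkIdeal (monomialIdeal (transformExp E π T n)) x' := by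
  classical
  have hE₀ : HasSNC (boundaryOf ((H, 0) :: E)) := hEs
  have hT₀ : ∀ K ∈ T, K ∈ boundaryOf ((H, 0) :: E) := hT
  have hst := congrArg (fun J => stalkIdeal J x') (comap_monomialIdeal hE₀ hT₀ hπ)
  simp only [List.map_cons] at hst
  rw [stalkIdeal_comap_eq_map_stalkMap, monomialIdeal_cons_zero, stalkIdeal_mul, stalkIdeal_pow, weightOf_cons_zero,
    monomialIdeal_cons_zero] at hst
  rw [hst, transformExp, monomialIdeal_append, monomialIdeal_singleton, stalkIdeal_mul, stalkIdeal_pow,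
    mul_comm (stalkIdeal (monomialIdeal _) x') (stalkIdeal _ x' ^ (weightOf E T - n)), ← mul_assoc, ← pow_add,
    Nat.add_sub_cancel' hnT]

omit [IsLocallyNoetherian X] in
/-- **`m₀ᵖ ∈ 𝓜(E)_y` forces `m₀ ∈ C_y`** for a face `T` of weight `≥ p ≥ 1` (over the centre a member of `T` of positive exponent
is a prime parameter dividing `m₀`; off the centre `C_y = 𝒪_y`). [folklore] -/
theorem mem_stalkIdeal_finsetSup_of_pow_mem (hEs : HasSNC (H :: boundaryOf E)) (hT : ∀ K ∈ T, K ∈ H :: boundaryOf E)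
    (hpT : p ≤ weightOf E T) (hp : p ≠ 0) {y : X} {m₀ : X.presheaf.stalk y}
    (hm : m₀ ^ p ∈ stalkIdeal (monomialIdeal E) y) : m₀ ∈ stalkIdeal (T.sup id) y := by
  classical
  by_cases hyC : y ∈ (T.sup id).support
  · have hyT : ∀ K ∈ T, y ∈ K.support := (mem_support_finsetSup_iff T y).mp hyC
    obtain ⟨K, hKT, hK0⟩ := exists_mem_expOf_ne_zero_of_weightOf_ne_zero (E := E) (T := T) (by omega)
    obtain ⟨d, z, lab, hz, hlab, -⟩ := exists_isRsopPart_lab hEs (hT K hKT) (hyT K hKT)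
    have hKy : stalkIdeal K y = Ideal.span {z (lab K)} := hlab K (hT K hKT) (hyT K hKT)
    have h1 : m₀ ^ p ∈ stalkIdeal K y := ((stalkIdeal_monomialIdeal_le_pow E K y).trans (Ideal.pow_le_self hK0)) hm
    rw [hKy, Ideal.mem_span_singleton] at h1
    have h2 : m₀ ∈ stalkIdeal K y := by
      rw [hKy, Ideal.mem_span_singleton]
      exact (hz.prime (lab K)).dvd_of_dvd_pow h1
    exact stalkIdeal_mono (Finset.le_sup (f := id) hKT) y h2
  · rw [stalkIdeal_eq_top_of_not_mem_support hyC]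
    exact Submodule.mem_top

omit [IsLocallyNoetherian X] in
/-- **THE DERIVATION EXTENDS THROUGH THE ROUND** (T19a at the stalks): a derivation `δ` of `𝒪_{X,π x'}` logarithmic for the
members of the face `T` through `π x'` extends to a derivation `δ'` of `𝒪_{X',x'}` with `δ' ∘ π^* = π^* ∘ δ` — the centre stalk
is spanned by labelled parameters `c_l` with `δ c_l ∈ (c_l)`, the local ring of `X'` at `x'` is a localization of a chart ring of
`Bl_{C_y} Spec 𝒪_y` (`IsBlowup.exists_reesChart_stalk`), and T19a extends `δ` to the chart ring and then to the localization.
[new] [cite: StacksProject, Tag 0804] [cite: Matsumura1987, §25] -/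
theorem exists_isDeriv_transform (hEs : HasSNC (H :: boundaryOf E)) (hT : ∀ K ∈ T, K ∈ H :: boundaryOf E)
    (hπ : IsBlowup π (T.sup id)) (x' : X') {δ : X.presheaf.stalk (π x') → X.presheaf.stalk (π x')} (hδ : IsDeriv δ)
    (hlog : ∀ K ∈ T, π x' ∈ K.support → ∀ g ∈ stalkIdeal K (π x'), δ g ∈ stalkIdeal K (π x')) :
    ∃ δ' : X'.presheaf.stalk x' → X'.presheaf.stalk x', IsDeriv δ' ∧
      ∀ a, δ' ((π.stalkMap x').hom a) = (π.stalkMap x').hom (δ a) := by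
  classical
  obtain ⟨k, c, hc, hlogc⟩ : ∃ (k : ℕ) (c : Fin k → X.presheaf.stalk (π x')),
      Ideal.span (Set.range c) = stalkIdeal (T.sup id) (π x') ∧ ∀ l, δ (c l) ∈ Ideal.span {c l} := by
    by_cases hyC : π x' ∈ (T.sup id).support
    · have hyT : ∀ K ∈ T, π x' ∈ K.support := (mem_support_finsetSup_iff T (π x')).mp hyC
      obtain ⟨d, z, -, ι, -, hι⟩ := exists_isRsopPart_labels_of_hasSNC hEs (π x')
      let c : Fin T.card → X.presheaf.stalk (π x') := fun l =>
        z (ι ⟨(T.equivFin.symm l).1, hT _ (T.equivFin.symm l).2, hyT _ (T.equivFin.symm l).2⟩)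
      have hcK : ∀ l, stalkIdeal (T.equivFin.symm l).1 (π x') = Ideal.span {c l} := fun l =>
        hι ⟨(T.equivFin.symm l).1, hT _ (T.equivFin.symm l).2, hyT _ (T.equivFin.symm l).2⟩
      have hcmem : ∀ l, c l ∈ stalkIdeal (T.equivFin.symm l).1 (π x') := fun l => by
        rw [hcK l]; exact Ideal.mem_span_singleton_self _
      refine ⟨T.card, c, ?_, fun l => ?_⟩
      · rw [stalkIdeal_finsetSup T (π x')]
        apply le_antisymm
        · rw [Ideal.span_le]
          rintro _ ⟨l, rfl⟩
          exact (Finset.le_sup (f := fun K => stalkIdeal K (π x')) (T.equivFin.symm l).2) (hcmem l)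
        · refine Finset.sup_le fun K hK => ?_
          have h := hcK (T.equivFin ⟨K, hK⟩)
          simp only [Equiv.symm_apply_apply] at h
          rw [h]
          exact Ideal.span_mono (Set.singleton_subset_iff.mpr (Set.mem_range_self _))
      · have h := hlog _ (T.equivFin.symm l).2 (hyT _ (T.equivFin.symm l).2) _ (hcmem l)
        rwa [hcK l] at h
    · refine ⟨1, fun _ => 1, ?_, fun l => ?_⟩
      · rw [stalkIdeal_eq_top_of_not_mem_support hyC]
        exact Ideal.eq_top_of_isUnit_mem _ (Ideal.subset_span (Set.mem_range_self (0 : Fin 1))) isUnit_one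
      · rw [Ideal.span_singleton_one]; exact Submodule.mem_top
  obtain ⟨j, 𝔴, χ, hχ, hloc, -⟩ := hπ.exists_reesChart_stalk x' c hc
  obtain ⟨D, hD, hDb⟩ := exists_isDeriv_chartRing_of_log c j hδ hlogc
  letI := χ.toAlgebra
  haveI : IsLocalization.AtPrime (X'.presheaf.stalk x') 𝔴.asIdeal := hloc
  obtain ⟨δ', hδ', hδ'D⟩ := hD.exists_extend (X'.presheaf.stalk x') 𝔴.asIdeal.primeCompl
  refine ⟨δ', hδ', fun a => ?_⟩
  have h := hδ'D (chartBase c j a)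
  rw [RingHom.algebraMap_toAlgebra, hχ, hDb, hχ] at h
  exact h

/-- **`p`-DIVISIBLE POINTS OF `V(H')` LIE OVER `p`-DIVISIBLE POINTS** (star bounds): off the centre the boundary through `x'` is
the boundary through `π x'` with the same exponents; over the centre, in phase 2 (`T = {H, K₀}`) the new exponent
`a_{K₀} − p ≡ 0` gives `p ∣ a_{K₀}` and the members off the face lift, while in phase `≥ 3` the star bounds leave no
`p`-divisible point over the centre (`weightOf E T < 2p` forces the new label `0`, and every other member through `π x'` has
exponent `< p`). [new] [cite: Kollar2007, (3.111) Step 3] -/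
theorem divPt_of_divPt_transform {r : ℕ} (hEs : HasSNC (H :: boundaryOf E)) (hT : ∀ K ∈ T, K ∈ H :: boundaryOf E)
    (hπ : IsBlowup π (T.sup id)) (hpT : p ≤ weightOf E T) (hTrH : T ∈ incSubsetsH E H r)
    (hstar : StarBelowH E H p r) (hH0 : expOf E H = 0) (hp : 2 ≤ p) {x' : X'}
    (hx'H : x' ∈ (strictTransformIdeal π (T.sup id) H).support) (hD : DivPt p (transformExp E π T p) x') :
    DivPt p E (π x') := by
  classical
  haveI : IsProper π := hπ.isProper
  haveI : IsLocallyNoetherian X' := LocallyOfFiniteType.isLocallyNoetherian π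
  obtain ⟨hdiv, G, hxG, hG0⟩ := hD
  have hyH : π x' ∈ H.support := mem_support_of_mem_support_strictTransformIdeal hx'H
  have hGb : G ∈ boundaryOf (transformExp E π T p) := mem_boundaryOf_of_expOf_ne_zero hG0
  rw [boundaryOf_transformExp, List.mem_append, List.mem_map, List.mem_singleton] at hGb
  have hvis : ∀ K ∈ boundaryOf E, x' ∈ (strictTransformIdeal π (T.sup id) K).support → p ∣ expOf E K :=
    fun K hK hxK => by
      have h := hdiv _ hxK
      rwa [expOf_transformExp_strict hEs hT hπ p hK hxK] at h
  by_cases hyC : π x' ∈ (T.sup id).support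
  · -- over the centre
    have hyT : ∀ K ∈ T, π x' ∈ K.support := (mem_support_finsetSup_iff T _).mp hyC
    have hxF : x' ∈ ((T.sup id).comap π).support := by
      show x' ∈ (((T.sup id).comap π).support : Set X')
      rw [Scheme.IdealSheafData.support_comap]
      exact hyC
    have hdvdW : p ∣ weightOf E T := by
      have h := hdiv _ hxF
      rw [expOf_transformExp_comap hEs hT hπ p hxF] at h
      have h' := (Nat.dvd_add_right h).mpr (dvd_refl p)
      rwa [Nat.sub_add_cancel hpT] at h'
    rcases star_dichotomy hTrH hstar hH0 hpT (by omega) with ⟨K₀, hK₀T, hK₀H, hWK₀, huniq⟩ | ⟨hW2, hsmall⟩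
    · refine ⟨fun K hyK => ?_, K₀, hyT K₀ hK₀T, by rw [← hWK₀]; omega⟩
      by_cases hK0 : expOf E K = 0
      · rw [hK0]; exact dvd_zero p
      have hKb : K ∈ boundaryOf E := mem_boundaryOf_of_expOf_ne_zero hK0
      by_cases hKT : K ∈ T
      · by_cases hKH : K = H
        · rw [hKH, hH0]; exact dvd_zero p
        · rw [huniq K hKT hKH, ← hWK₀]; exact hdvdW
      · exact hvis K hKb (mem_support_strict_of_not_mem_face hEs hT hπ (List.mem_cons_of_mem _ hKb) hKT hyK)
    · exfalso
      have hWp : weightOf E T = p := by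
        obtain ⟨c, hc⟩ := hdvdW
        rcases c with _ | _ | c
        · omega
        · omega
        · nlinarith
      rcases hGb with ⟨K, hK, rfl⟩ | rfl
      · have hyK : π x' ∈ K.support := mem_support_of_mem_support_strictTransformIdeal hxG
        rw [expOf_transformExp_strict hEs hT hπ p hK hxG] at hG0
        have hdvdK : p ∣ expOf E K := hvis K hK hxG
        have hKH : K ≠ H := fun h => hG0 (by rw [h, hH0])
        have hlt := hsmall K (mem_sheaves_iff.mpr hK) hKH (π x') hyH hyK
        exact absurd (Nat.le_of_dvd (Nat.pos_of_ne_zero hG0) hdvdK) (not_le.mpr hlt)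
      · rw [expOf_transformExp_comap hEs hT hπ p hxG] at hG0
        omega
  · -- off the centre
    have hxF : x' ∉ ((T.sup id).comap π).support := fun h => hyC (by
      have h' : x' ∈ ((((T.sup id).comap π).support : Set X')) := h
      rwa [Scheme.IdealSheafData.support_comap] at h')
    refine ⟨fun K hyK => ?_, ?_⟩
    · by_cases hK0 : expOf E K = 0
      · rw [hK0]; exact dvd_zero p
      · exact hvis K (mem_boundaryOf_of_expOf_ne_zero hK0) (mem_support_strictTransformIdeal_of_not_mem hyC hyK)
    · rcases hGb with ⟨K, hK, rfl⟩ | rfl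
      · refine ⟨K, mem_support_of_mem_support_strictTransformIdeal hxG, ?_⟩
        rwa [expOf_transformExp_strict hEs hT hπ p hK hxG] at hG0
      · exact absurd hxG hxF

end Round

end Summit.ResolutionOfSingularities.ResolutionOfSingularities.Theorems.DeltaCutClasses

end
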